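import Summits.CriticalPhenomena.PercolationContinuityZ3.Theorems.PercNearOneGluingNoHeavyLowerTailAntitheticPendant
import HarnessLib

/-!
# `NoHeavyLowerTail` (stmt-CriticalPhenomena-4575) — antithetic cluster pairs: the trivial base blocks for block reduction (prim-hp-2 gen 39;
# HOME/MEMO-gen39-pendant.md §2c)

Support file (`--supports stmt-CriticalPhenomena-4575`, hull-port prover `prim-hp-2`, gen 39).  No definitions, no named facts, no sorries; standard axioms.

The block reduction of MEMO-gen39 §2 (cut-vertex theorem `Antithetic.Glue.tsum_union_nonneg`) ends at blocks; the two trivial ones are recorded here so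
that census claims correspond to tree theorems:
* `Antithetic.Pendant.good_of_no_pairs` — an edge set all of whose members at reachable … simply: if `E` contains no non-loop pair then `T_E(R,X) = 0`;
  in particular `good(∅)`.
* `Antithetic.Pendant.good_single_pair` — the block `K₂`: `E = {ab}` seen from its endpoint `a` (`b ≠ a`, `b ∉ X`) is good for every `R`, `X`
  (pendant-edge lemma applied to the empty edge set).
[cite: VandenbergHaggstromKahn2005, §1 p. 3 (open cluster `C_s`)]
-/

noncomputable section

namespace Summit.CriticalPhenomena.PercolationContinuityZ3.Theorems

open Literature.Probability.Percolation
open scoped Classical symmDiff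

namespace Antithetic

namespace Pendant

variable {V : Type*} [Fintype V]

/-- An edge set without non-loop pairs has empty clusters, so its antithetic functional vanishes: `T_E(R,X) = 0`. [this work] -/
theorem tsum_eq_zero_of_no_pairs (F G : Set (Sym2 V) → ℝ) (E : Set (Sym2 V)) (hE : ∀ e ∈ E, e.IsDiag) (s : V) (R X : Set V) :
    Peel.tsum F G E s R X = 0 := by
  unfold Peel.tsum
  refine Finset.sum_eq_zero fun ω _ => ?_
  have h0 : ∀ η : Set (Sym2 V), η ⊆ E → openEdgeCluster η s = ∅ := fun η hη => by
    ext e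
    simp only [Set.mem_empty_iff_false, iff_false]
    exact fun he => he.2.1 (hE e (hη he.1))
  unfold Peel.delta
  rw [h0 (ω ∩ E) Set.inter_subset_right, h0 (ωᶜ ∩ E) Set.inter_subset_right, sub_self, zero_mul]

/-- **`good(E)` for an edge set without non-loop pairs** (in particular `E = ∅`). [this work] -/
theorem good_of_no_pairs (E : Set (Sym2 V)) (hE : ∀ e ∈ E, e.IsDiag) (s : V) (R X : Set V) :
    ∀ F G : Set (Sym2 V) → ℝ, Monotone F → Monotone G → 0 ≤ Peel.tsum F G E s R X :=
  fun F G _ _ => (tsum_eq_zero_of_no_pairs F G E hE s R X).ge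

/-- **The block `K₂` is good**: the single pair `ab` seen from its endpoint `a` (`b ≠ a`, `b ∉ X`) has `T(R,X) ≥ 0` for every `R` and all increasing
`F, G` — the pendant-edge lemma applied to the empty edge set. [this work] -/
theorem good_single_pair (a b : V) (hab : a ≠ b) (R X : Set V) (hX : b ∉ X) :
    ∀ F G : Set (Sym2 V) → ℝ, Monotone F → Monotone G → 0 ≤ Peel.tsum F G ({s(a, b)} : Set (Sym2 V)) a R X := by
  intro F G hF hG
  have h : ({s(a, b)} : Set (Sym2 V)) = insert s(a, b) (∅ : Set (Sym2 V)) := by ext e; simp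
  rw [h]
  exact good_insert (E := (∅ : Set (Sym2 V))) (fun _ hf _ => absurd hf (Set.notMem_empty _)) hab hab R X hX
    (good_of_no_pairs ∅ (fun _ he => absurd he (Set.notMem_empty _)) a R X) hF hG

end Pendant

end Antithetic

end Summit.CriticalPhenomena.PercolationContinuityZ3.Theorems
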